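import Literature.Geometry.Kaehler.ComplexTorusSimpleAbelianThreefoldHodgeGroupDimension
import HarnessLib

/-!
# Moonen–Zarhin 1999 (2.3), `g = 3`, AS ONE THEOREM: «There are four cases» — a simple complex abelian threefold is of
# type I(1) (`End⁰ = ℚ`, `Hg = Sp₆`, `dim 21`), I(3) (totally real cubic field, `dim 9`), IV(1,1) (imaginary quadratic
# field, `dim 9`) or IV(3,1) (sextic CM field, CM type, `dim 3`); `End⁰(X)` is a field in every case

Layer `Literature/Geometry/Kaehler`, namespace `Literature.Geometry.Kaehler.ComplexTorus`; lane `lit-hodgefound`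
(Track 2 foundations library), Layer A2 ∕ A4, prover seat `lit-hodgefound-p17` (generation 51), self-proposed row g51-#4
(gen-50 FREE POINTER 1) — the ASSEMBLY of the tree's case-by-case results g50-#4
(`ComplexTorusMaximalRealMultiplicationHodgeLieAlgebraDimension` §3), g50-#7 (`ComplexTorusSimpleAbelianThreefoldStablyNondegenerate`),
g50-#8 (`ComplexTorusSimpleAbelianThreefoldHodgeGroupDimension`) into the printed four-case statement, with the dictionary
`e = [F:ℚ] ↔ dim Hg(X)` and the public forms of two helpers the gen-50 files kept private (`End⁰(X)` commutative when
`[End⁰(X) : F] = 1`; for every simple threefold).  THEOREMS ONLY (no definition, no instance, no notation, no named fact;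
D-0026, net debt 0).

## Source, VERBATIM (held `paper:arxiv-math_9901113`, p0005 L81–L106)

B. J. J. Moonen, Yu. G. Zarhin [MoonenZarhin1999LowDim], *Hodge classes on abelian varieties of low dimension*, Math. Ann.
**315** (1999), §2 (2.3): «`g = 3`. There are four cases.  Type I(1): `X` is an abelian 3-fold with `End⁰(X) = ℚ`. Then
`Hg(X) = Sp(V,φ) ≅ Sp_{6,ℚ}`.  Type I(3): `End⁰(X) = F` is a totally real cubic field. There is a unique `F`-symplectic form
`ψ : V × V → F` such that `φ = trace_{F/ℚ} ψ`. The Hodge group is given by `Hg(X) = Res_{F/ℚ} Sp_F(V,ψ)`.  Type IV(1,1):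
`End⁰(X) = F` is an imaginary quadratic field; given `a ∈ F` with `ā = −a` there is a unique `F`-hermitian form
`ψ : V × V → F` such that `φ = trace_{F/ℚ}(a·ψ)` and `Hg(X) = U_F(V,ψ)`.  Type IV(3,1): `End⁰(X) = F` is a CM-field of
degree `6` over `ℚ`. Then `Hg(X) = U_F`.»; (2.4)(2) (p0005 L116–L118): «Suppose `X` is of CM-type. Then `Hg(X)` is a
`g`-dimensional algebraic torus.»  Dimensions: `dim Sp₆ = 21`, `dim Res_{F/ℚ} SL_{2,F} = 9`, `dim U_F(V,ψ) = dim U(2,1) = 9`,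
`dim U_F = 3` ([Gordon1997] 6.4, 2.12–2.13; [Milne1999LefschetzClasses] §2 table).
Also: H. Lange [Lange2023AbelianVarietiesComplex], §2.6.1 Proposition (table `e·d² ∣ 2g`: `d = 1` for `g = 3`).

## Contents

* §1 **`IsSimple.endAlgRat_comm_of_finrank_centerField_endAlgRat_eq_one`** (`[End⁰(X) : F] = 1 ⟹ End⁰(X)` commutative),
  `IsSimple.range_valAlgHom_eq_endAlgRat_of_finrank_eq_three` (`End⁰(X) = F` for every simple threefold),
  **`IsSimple.endAlgRat_comm_of_finrank_eq_three`**, `IsSimple.finrank_centerField_mem_of_finrank_eq_three`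
  (`e ∈ {1, 2, 3, 6}`).
* §2 **`IsSimple.four_cases_of_finrank_eq_three`** — the printed statement: (I(1) ∧ `End⁰ = ℚ` ∧ `Hg = Sp₆` ∧ `dim 21`) ∨
  (I(3) ∧ `dim 9`) ∨ (IV(1,1) ∧ `dim 9`) ∨ (IV(3,1) ∧ CM type ∧ `dim 3`), every case with `[End⁰(X) : F] = 1`; and the
  dictionary **`IsSimple.finrank_hodgeGroupLie_eq_three_iff_finrank_centerField_eq_six_of_finrank_eq_three`**,
  **`IsSimple.finrank_hodgeGroupLie_eq_nine_iff_of_finrank_eq_three`** (`dim 9 ⟺ e ∈ {2, 3}`),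
  `IsSimple.finrank_centerField_eq_one_iff_endAlgRat_eq_bot_of_finrank_eq_three`.
-/

noncomputable section

open scoped Matrix
open Module Matrix NormedSpace NumberField
open Literature.NumberTheory.Automorphic (IsTorusSubgroup)

namespace Literature.Geometry.Kaehler

namespace ComplexTorus

/-! ## §1 `End⁰(X) = F` is a field for a simple threefold; `e ∈ {1, 2, 3, 6}` -/

section EndField

variable {κ : Type} [Fintype κ] [DecidableEq κ] [Nonempty κ] {E : Type} [NormedAddCommGroup E] [NormedSpace ℂ E]
  [FiniteDimensional ℂ E] {Ψ : (κ → ℝ) ≃L[ℝ] E} {η : E [⋀^Fin 2]→L[ℝ] ℝ}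

omit [FiniteDimensional ℂ E] in
/-- **`[End⁰(X) : F] = 1` (the endomorphism algebra IS its centre `F`) ⟹ `End⁰(X)` is commutative** — the common
situation of the four cases of (2.3) and of types I(1), I(2), IV(2,1) at `g = 2` («`End⁰(X) = F`»).
[cite: MoonenZarhin1999LowDim, §2 (2.2)–(2.3) (p0005 L52–L106)] [cite: Lange2023AbelianVarietiesComplex, §2.6.1 Proposition (`d = 1`)] -/
theorem IsSimple.endAlgRat_comm_of_finrank_centerField_endAlgRat_eq_one (hX : IsSimple Ψ)
    (h1 : finrank (centerField Ψ hX) (endAlgRat Ψ) = 1) :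
    ∀ a ∈ endAlgRat Ψ, ∀ b ∈ endAlgRat Ψ, a * b = b * a := fun a ha b hb ↦ by
  rw [← hX.range_valAlgHom_eq_endAlgRat_of_finrank_eq_one h1] at ha hb
  obtain ⟨x, rfl⟩ := (AlgHom.mem_range _).1 ha
  obtain ⟨y, rfl⟩ := (AlgHom.mem_range _).1 hb
  rw [← map_mul, ← map_mul, mul_comm]

/-- **`End⁰(X) = F` FOR EVERY SIMPLE COMPLEX ABELIAN THREEFOLD**: the endomorphism algebra is (the image of) its centre,
a number field (`[End⁰(X) : F] = d² ∣ 2g/e` forces `d = 1` at `g = 3`; the four cases of (2.3) all read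
«`End⁰(X) = ℚ`», «`End⁰(X) = F`»). [cite: MoonenZarhin1999LowDim, §2 (2.3) `g = 3` (p0005 L83–L106)]
[cite: Lange2023AbelianVarietiesComplex, §2.6.1 Proposition (table, `e·d² ∣ 2g`)] -/
theorem IsSimple.range_valAlgHom_eq_endAlgRat_of_finrank_eq_three (hX : IsSimple Ψ) (h3 : finrank ℂ E = 3) :
    (centerField.valAlgHom Ψ hX).range = endAlgRat Ψ :=
  hX.range_valAlgHom_eq_endAlgRat_of_finrank_eq_one (hX.finrank_centerField_endAlgRat_eq_one_of_finrank_eq_three h3)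

/-- **The endomorphism algebra of a simple complex abelian threefold is commutative** (a field: `ℚ`, a totally real
cubic field, an imaginary quadratic field or a sextic CM field). [cite: MoonenZarhin1999LowDim, §2 (2.3) `g = 3` (p0005 L83–L106)]
[cite: Lange2023AbelianVarietiesComplex, §2.6.1 Proposition] -/
theorem IsSimple.endAlgRat_comm_of_finrank_eq_three (hX : IsSimple Ψ) (h3 : finrank ℂ E = 3) :
    ∀ a ∈ endAlgRat Ψ, ∀ b ∈ endAlgRat Ψ, a * b = b * a :=
  hX.endAlgRat_comm_of_finrank_centerField_endAlgRat_eq_one (hX.finrank_centerField_endAlgRat_eq_one_of_finrank_eq_three h3)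

/-- A CM field is not totally real. [folklore] -/
private theorem not_isTotallyReal_of_isCMField₅₁ (K : Type*) [Field K] [NumberField K] [IsCMField K] :
    ¬ IsTotallyReal K := fun _ ↦ by
  obtain ⟨w⟩ := (inferInstance : Nonempty (InfinitePlace K))
  exact (InfinitePlace.not_isReal_iff_isComplex.2 (IsTotallyComplex.isComplex w)) (IsTotallyReal.isReal w)

/-- **`e = [F : ℚ] ∈ {1, 3, 2, 6}` for the centre `F` (`= End⁰(X)`) of a simple polarised complex abelian threefold** —
`1, 3` when `F` is totally real (types I(1), I(3)), `2, 6` when `F` is a CM field (types IV(1,1), IV(3,1)).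
[cite: MoonenZarhin1999LowDim, §2 (2.3) `g = 3` (p0005 L83–L106)] [cite: Lange2023AbelianVarietiesComplex, §2.6.1 Proposition (`e ∣ g` resp. `e₀ ∣ g`)] -/
theorem IsSimple.finrank_centerField_mem_of_finrank_eq_three (hX : IsSimple Ψ) (hη : IsRiemannForm Ψ η)
    (h3 : finrank ℂ E = 3) :
    (IsTotallyReal (centerField Ψ hX) ∧ (finrank ℚ (centerField Ψ hX) = 1 ∨ finrank ℚ (centerField Ψ hX) = 3)) ∨
      (IsCMField (centerField Ψ hX) ∧ (finrank ℚ (centerField Ψ hX) = 2 ∨ finrank ℚ (centerField Ψ hX) = 6)) := by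
  rcases hX.centerField_isTotallyReal_or_isCMField hη with hR | hCM
  · haveI := hR
    exact Or.inl ⟨hR, hX.finrank_centerField_eq_one_or_eq_three_of_isTotallyReal h3⟩
  · haveI := hCM
    exact Or.inr ⟨hCM, hX.finrank_centerField_eq_two_or_eq_six_of_finrank_eq_three h3⟩

end EndField

/-! ## §2 The four cases, with groups and dimensions; the dictionary `e ↔ dim Hg(X)` -/

section FourCases

variable {κ : Type} [Fintype κ] [DecidableEq κ] [Nonempty κ] {E : Type} [NormedAddCommGroup E] [NormedSpace ℂ E]
  [FiniteDimensional ℂ E] {Ψ : (κ → ℝ) ≃L[ℝ] E} {η : E [⋀^Fin 2]→L[ℝ] ℝ}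

/-- **MOONEN–ZARHIN (2.3), `g = 3`: «THERE ARE FOUR CASES»** for a simple polarised complex abelian threefold `X` with
centre `F` of `End⁰(X)` (and `End⁰(X) = F` throughout, `[End⁰(X) : F] = 1`):
**I(1)** `F = ℚ` totally real of degree `1`, `End⁰(X) = ℚ`, `Hg(X) = Sp(V,φ) ≅ Sp₆` (`Hg(X)(ℝ) = Sp(V,E)(ℝ)`), `dim Hg(X) = 21`;
**I(3)** `F` a totally real cubic field, `dim Hg(X) = 9` (`= dim Res_{F/ℚ} SL_{2,F}`; `Hg = Lf` is g50-#4);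
**IV(1,1)** `F` an imaginary quadratic field, `dim Hg(X) = 9` (`= dim U_F(V,ψ)`, signature `(2,1)`; g50-#6∕#8);
**IV(3,1)** `F` a CM field of degree `6`, `X` of CM type (`MT(X)(ℂ)` a torus) and `dim Hg(X) = 3` (`= dim U_F`, «a
`g`-dimensional algebraic torus»).  Here `dim Hg(X)` is `dim_ℝ` of the real Hodge Lie algebra `𝔥𝔤_ℝ = Lie Hg(X)(ℝ)`.
[cite: MoonenZarhin1999LowDim, §2 (2.3) `g = 3` (p0005 L81–L106) and Prop. (2.4)(2) (p0005 L116–L118)]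
[cite: Gordon1997, Thm. 6.4 (Hazama: `dim Hg = dim`), 2.12–2.13] [cite: Lange2023AbelianVarietiesComplex, §2.6.1 Proposition] -/
theorem IsSimple.four_cases_of_finrank_eq_three (hX : IsSimple Ψ) (hη : IsRiemannForm Ψ η) (h3 : finrank ℂ E = 3) :
    finrank (centerField Ψ hX) (endAlgRat Ψ) = 1 ∧
      ((IsTotallyReal (centerField Ψ hX) ∧ finrank ℚ (centerField Ψ hX) = 1 ∧ endAlgRat Ψ = ⊥ ∧
          hodgeGroup Ψ = spGroup Ψ η ∧ finrank ℝ (hodgeGroupLie Ψ) = 21) ∨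
        (IsTotallyReal (centerField Ψ hX) ∧ finrank ℚ (centerField Ψ hX) = 3 ∧ finrank ℝ (hodgeGroupLie Ψ) = 9) ∨
        (IsCMField (centerField Ψ hX) ∧ finrank ℚ (centerField Ψ hX) = 2 ∧ finrank ℝ (hodgeGroupLie Ψ) = 9) ∨
        (IsCMField (centerField Ψ hX) ∧ finrank ℚ (centerField Ψ hX) = 6 ∧ IsTorusSubgroup (mumfordTateGroupC Ψ) ∧
          finrank ℝ (hodgeGroupLie Ψ) = 3)) := by
  have h1 := hX.finrank_centerField_endAlgRat_eq_one_of_finrank_eq_three h3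
  refine ⟨h1, ?_⟩
  rcases hX.centerField_isTotallyReal_or_isCMField hη with hR | hCM
  · haveI := hR
    rcases hX.finrank_hodgeGroupLie_eq_of_isTotallyReal_of_finrank_eq_three hη h3 with ⟨he, hd⟩ | ⟨he, hd⟩
    · have hbot := hX.endAlgRat_eq_bot_of_finrank_eq_one_of_finrank_centerField_eq_one h1 he
      exact Or.inl ⟨hR, he, hbot, (hη.hodgeGroup_eq_spGroup_iff_endAlgRat_eq_bot_of_finrank_eq_three h3).2 hbot, hd⟩
    · exact Or.inr (Or.inl ⟨hR, he, hd⟩)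
  · haveI := hCM
    rcases hX.finrank_hodgeGroupLie_eq_of_isCMField_of_finrank_eq_three hη h3 with ⟨he, hd⟩ | ⟨he, hd⟩
    · exact Or.inr (Or.inr (Or.inl ⟨hCM, he, hd⟩))
    · exact Or.inr (Or.inr (Or.inr ⟨hCM, he, hX.isTorusSubgroup_mumfordTateGroupC_of_finrank_centerField_eq_six h3 he, hd⟩))

/-- **`dim Hg(X) = 3 ⟺ e = 6` (type IV(3,1), the CM-type case)** for a simple polarised abelian threefold.
[cite: MoonenZarhin1999LowDim, §2 (2.3) `g = 3`, Type IV(3,1) and Prop. (2.4)(2) (p0005 L104–L118)] [cite: Gordon1997, 2.12 and Thm. 6.4] -/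
theorem IsSimple.finrank_hodgeGroupLie_eq_three_iff_finrank_centerField_eq_six_of_finrank_eq_three (hX : IsSimple Ψ)
    (hη : IsRiemannForm Ψ η) (h3 : finrank ℂ E = 3) :
    finrank ℝ (hodgeGroupLie Ψ) = 3 ↔ finrank ℚ (centerField Ψ hX) = 6 := by
  rcases (hX.four_cases_of_finrank_eq_three hη h3).2 with
    ⟨-, he, -, -, hd⟩ | ⟨-, he, hd⟩ | ⟨-, he, hd⟩ | ⟨-, he, -, hd⟩ <;> simp [he, hd]

/-- **`dim Hg(X) = 9 ⟺ e ∈ {2, 3}` (types IV(1,1) and I(3))** for a simple polarised abelian threefold.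
[cite: MoonenZarhin1999LowDim, §2 (2.3) `g = 3`, Types I(3), IV(1,1) (p0005 L88–L103)] [cite: Gordon1997, Thm. 6.4] -/
theorem IsSimple.finrank_hodgeGroupLie_eq_nine_iff_of_finrank_eq_three (hX : IsSimple Ψ) (hη : IsRiemannForm Ψ η)
    (h3 : finrank ℂ E = 3) :
    finrank ℝ (hodgeGroupLie Ψ) = 9 ↔ finrank ℚ (centerField Ψ hX) = 2 ∨ finrank ℚ (centerField Ψ hX) = 3 := by
  rcases (hX.four_cases_of_finrank_eq_three hη h3).2 with
    ⟨-, he, -, -, hd⟩ | ⟨-, he, hd⟩ | ⟨-, he, hd⟩ | ⟨-, he, -, hd⟩ <;> simp [he, hd]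

/-- **`e = 1 ⟺ End⁰(X) = ℚ` (type I(1), `Hg = Sp₆`, `dim 21`)** for a simple polarised abelian threefold.
[cite: MoonenZarhin1999LowDim, §2 (2.3) `g = 3`, Type I(1) (p0005 L85–L87)] [cite: Lange2023AbelianVarietiesComplex, §2.6.1 Proposition] -/
theorem IsSimple.finrank_centerField_eq_one_iff_endAlgRat_eq_bot_of_finrank_eq_three (hX : IsSimple Ψ)
    (hη : IsRiemannForm Ψ η) (h3 : finrank ℂ E = 3) :
    finrank ℚ (centerField Ψ hX) = 1 ↔ endAlgRat Ψ = ⊥ := by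
  rw [← hη.finrank_hodgeGroupLie_eq_iff_endAlgRat_eq_bot_of_finrank_eq_three h3]
  rcases (hX.four_cases_of_finrank_eq_three hη h3).2 with
    ⟨-, he, -, -, hd⟩ | ⟨-, he, hd⟩ | ⟨-, he, hd⟩ | ⟨-, he, -, hd⟩ <;> simp [he, hd]

/-- **The totally real and the CM cases exclude each other**: a simple polarised threefold is of type I (`e ∈ {1,3}`)
iff it is not of type IV (`e ∈ {2,6}`), i.e. `F` totally real ⟺ `e` odd ⟺ `dim Hg(X) ∈ {21} ∪ {9 with e = 3}`.
Recorded as: `F` is a CM field iff `e` is even. [cite: MoonenZarhin1999LowDim, §2 (2.3) `g = 3` (p0005 L83–L106)]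
[cite: Lange2023AbelianVarietiesComplex, §2.6.1 Proposition] -/
theorem IsSimple.isCMField_centerField_iff_even_of_finrank_eq_three (hX : IsSimple Ψ) (hη : IsRiemannForm Ψ η)
    (h3 : finrank ℂ E = 3) : IsCMField (centerField Ψ hX) ↔ Even (finrank ℚ (centerField Ψ hX)) := by
  rcases hX.finrank_centerField_mem_of_finrank_eq_three hη h3 with ⟨hR, he⟩ | ⟨hCM, he⟩
  · haveI := hR
    refine ⟨fun hCM ↦ absurd hR (@not_isTotallyReal_of_isCMField₅₁ _ _ _ hCM), fun hev ↦ ?_⟩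
    exfalso
    rcases he with he | he <;> rw [he] at hev <;> revert hev <;> decide
  · refine ⟨fun _ ↦ ?_, fun _ ↦ hCM⟩
    rcases he with he | he <;> rw [he] <;> decide

end FourCases

end ComplexTorus

end Literature.Geometry.Kaehler
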